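import Literature.Computability.QuantumComplexity.PauliParseval
import HarnessLib

/-!
# Local operations in the Pauli picture: single-site conjugation, twirl, noise, unitaries

Generic (`ι`-indexed register) versions of Observations 2 and 4 of Kempe–Regev–Unger–de Wolf,
Quantum Inf. Comput. 10 (2010) 361–376 [KempeEtAl2010], phrased for the Pauli coefficients
`pauliCoeff M S = Tr(S M)` and weights `pauliWeight M W` of `PauliExpansion.lean`:

* conjugating by the single-site Pauli `σ_Q` at wire `j` multiplies `Tr(S M)` by the sign
  `±1` of the (anti)commutation of `σ_Q` with `S_j` (`pauliCoeff_single_conj`); hence the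
  uniform **Pauli twirl** at `j` kills exactly the coefficients with `S_j ≠ I`
  (`pauliCoeff_twirl`) and `p`-**depolarizing noise** at `j` shrinks them by `1 − p`
  (`pauliCoeff_depolarize`, Observation 4);
* splitting the strings on `W` along a wire `j ∈ W` (`sum_stringsOn_eq_sum_erase`);
* the iterated twirl over a list of wires and the identity
  `pauliWeight M W = 2^{|ι|} ‖D_{ι∖W} M‖²_{HS}` (`pauliWeight_eq_card_pow_mul_norm_twirlList`);
* **unitary invariance** (Observation 2, localised): if `U` is unitary and commutes with every
  single-site Pauli outside `W`, then `pauliWeight (U M Uᴴ) W = pauliWeight M W`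
  (`pauliWeight_unitary_conj`).

## References

* [KempeEtAl2010] J. Kempe, O. Regev, F. Unger, R. de Wolf, Quantum Inf. Comput. 10 (2010)
  361–376; arXiv:0802.1464, §2, Observations 2 and 4.
-/

noncomputable section

open Matrix Finset

namespace Literature.Computability.QuantumComplexity

variable {ι : Type*} [Fintype ι] [DecidableEq ι]

/-! ### Single-site Pauli strings and conjugation signs -/

/-- The single-site string `I…I Q I…I` (letter `Q` at wire `j`) as a tensor product with one
non-trivial slot. [folklore] -/
theorem pauliString_update_const (j : ι) (Q : Pauli) :
    pauliString (Function.update (fun _ : ι => Pauli.I) j Q) =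
      tensorAll (Function.update (fun _ : ι => (1 : Matrix Bool Bool ℂ)) j (Pauli.mat Q)) := by
  rw [pauliString_eq]
  congr 1
  funext i
  by_cases h : i = j
  · subst h; simp
  · simp [Function.update_of_ne h, Pauli.mat]

/-- Conjugating a Pauli string by the single-site Pauli `σ_Q` at `j` gives `± S`:
`σ_Q^{(j)} S σ_Q^{(j)} = sign(Q, S_j) S`. [cite: KempeEtAl2010, Observation 4 (proof)] -/
theorem single_mul_pauliString_mul_single (j : ι) (Q : Pauli) (S : ι → Pauli) :
    pauliString (Function.update (fun _ : ι => Pauli.I) j Q) * pauliString S *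
      pauliString (Function.update (fun _ : ι => Pauli.I) j Q) = Pauli.sign Q (S j) • pauliString S := by
  rw [pauliString_update_const, pauliString_eq, tensorAll_mul, tensorAll_mul]
  have key : (fun i => Function.update (fun _ : ι => (1 : Matrix Bool Bool ℂ)) j (Pauli.mat Q) i *
      (S i).mat * Function.update (fun _ : ι => (1 : Matrix Bool Bool ℂ)) j (Pauli.mat Q) i) =
      Function.update (fun i => (S i).mat) j (Pauli.sign Q (S j) • (S j).mat) := by
    funext i
    by_cases h : i = j
    · subst h
      simp only [Function.update_self]
      exact Pauli.mat_mul_mat_mul_mat Q (S i)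
    · simp [Function.update_of_ne h]
  rw [key, tensorAll_update_smul]
  congr 1
  rw [Function.update_eq_self]

/-- **Conjugation by a single-site Pauli in the Pauli picture**:
`Tr(S · σ_Q^{(j)} M σ_Q^{(j)}) = sign(Q, S_j) Tr(S M)`. [cite: KempeEtAl2010, Observation 4 (proof)] -/
theorem pauliCoeff_single_conj (j : ι) (Q : Pauli) (M : Matrix (ι → Bool) (ι → Bool) ℂ)
    (S : ι → Pauli) :
    pauliCoeff (pauliString (Function.update (fun _ : ι => Pauli.I) j Q) * M *
      pauliString (Function.update (fun _ : ι => Pauli.I) j Q)) S = Pauli.sign Q (S j) * pauliCoeff M S := by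
  rw [pauliCoeff_eq, pauliCoeff_eq, ← Matrix.mul_assoc, ← Matrix.mul_assoc, trace_mul_comm,
    ← Matrix.mul_assoc, ← Matrix.mul_assoc, single_mul_pauliString_mul_single, Matrix.smul_mul,
    trace_smul, smul_eq_mul]

/-- **The uniform Pauli twirl at wire `j` in the Pauli picture** (Observation 4 with `p = 1`):
`¼ Σ_Q σ_Q^{(j)} M σ_Q^{(j)}` keeps the coefficients with `S_j = I` and kills the others.
[cite: KempeEtAl2010, Observation 4] -/
theorem pauliCoeff_twirl (j : ι) (M : Matrix (ι → Bool) (ι → Bool) ℂ) (S : ι → Pauli) :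
    pauliCoeff ((1 / 4 : ℂ) • ∑ Q, pauliString (Function.update (fun _ : ι => Pauli.I) j Q) * M *
      pauliString (Function.update (fun _ : ι => Pauli.I) j Q)) S =
      (if S j = Pauli.I then 1 else 0) * pauliCoeff M S := by
  rw [pauliCoeff_smul, pauliCoeff_sum]
  simp only [pauliCoeff_single_conj, ← Finset.sum_mul, Pauli.sum_sign]
  split_ifs <;> ring

/-- **Depolarizing noise in the Pauli basis** (Observation 4): `p`-depolarizing noise at wire `j`,
`M ↦ (1 − p) M + p · twirl_j(M)`, multiplies `Tr(S M)` by `1` if `S_j = I` and by `1 − p`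
otherwise. [cite: KempeEtAl2010, Observation 4] -/
theorem pauliCoeff_depolarize (p : ℂ) (j : ι) (M : Matrix (ι → Bool) (ι → Bool) ℂ) (S : ι → Pauli) :
    pauliCoeff ((1 - p) • M + p • ((1 / 4 : ℂ) • ∑ Q,
      pauliString (Function.update (fun _ : ι => Pauli.I) j Q) * M *
        pauliString (Function.update (fun _ : ι => Pauli.I) j Q))) S =
      (if S j = Pauli.I then 1 else 1 - p) * pauliCoeff M S := by
  rw [pauliCoeff_add, pauliCoeff_smul, pauliCoeff_smul, pauliCoeff_twirl]
  split_ifs <;> ring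

/-! ### Splitting the strings on `W` along one wire -/

/-- For `j ∈ W`, the strings on `W` are the strings on `W ∖ {j}` with an arbitrary letter put
at `j`: `Σ_{S ∈ 𝒫^W} f(S) = Σ_{S' ∈ 𝒫^{W∖j}} Σ_Q f(S'[j ↦ Q])`.
[cite: KempeEtAl2010, §3.1.2 (sums over 𝒫^{V∖A} × 𝒫^A)] -/
theorem sum_stringsOn_eq_sum_erase {β : Type*} [AddCommMonoid β] {W : Finset ι} {j : ι}
    (hj : j ∈ W) (f : (ι → Pauli) → β) :
    ∑ S ∈ stringsOn W, f S = ∑ S' ∈ stringsOn (W.erase j), ∑ Q, f (Function.update S' j Q) := by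
  classical
  rw [← Finset.sum_product' (s := stringsOn (W.erase j)) (t := Finset.univ)
    (f := fun S' Q => f (Function.update S' j Q))]
  refine Finset.sum_nbij' (fun S => (Function.update S j Pauli.I, S j))
    (fun p => Function.update p.1 j p.2) ?_ ?_ ?_ ?_ ?_
  · intro S hS
    rw [Finset.mem_product]
    refine ⟨mem_stringsOn.2 fun i hi => ?_, Finset.mem_univ _⟩
    change Function.update S j Pauli.I i = Pauli.I
    by_cases h : i = j
    · subst h; simp
    · rw [Function.update_of_ne h]
      exact mem_stringsOn.1 hS i fun hi' => hi (Finset.mem_erase.2 ⟨h, hi'⟩)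
  · rintro ⟨S', Q⟩ hp
    rw [Finset.mem_product] at hp
    refine mem_stringsOn.2 fun i hi => ?_
    change Function.update S' j Q i = Pauli.I
    have h : i ≠ j := fun h => hi (h ▸ hj)
    rw [Function.update_of_ne h]
    exact mem_stringsOn.1 hp.1 i fun hi' => hi (Finset.mem_of_mem_erase hi')
  · intro S _
    simp
  · rintro ⟨S', Q⟩ hp
    rw [Finset.mem_product] at hp
    have hS'j : S' j = Pauli.I := mem_stringsOn.1 hp.1 j (Finset.notMem_erase j W)
    ext
    · simp only [Function.update_idem]
      rw [← hS'j, Function.update_eq_self]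
    · simp
  · intro S _
    simp

/-- Splitting the Pauli weight on `W` along `j ∈ W`. [cite: KempeEtAl2010, §3.1.2] -/
theorem pauliWeight_eq_sum_erase (M : Matrix (ι → Bool) (ι → Bool) ℂ) {W : Finset ι} {j : ι}
    (hj : j ∈ W) :
    pauliWeight M W = ∑ S' ∈ stringsOn (W.erase j), ∑ Q, ‖pauliCoeff M (Function.update S' j Q)‖ ^ 2 := by
  rw [pauliWeight_eq, sum_stringsOn_eq_sum_erase hj]

/-- The weight on `W ∖ {j}` through strings updated at `j` with `I`. [folklore] -/
theorem pauliWeight_erase_eq (M : Matrix (ι → Bool) (ι → Bool) ℂ) (W : Finset ι) (j : ι) :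
    pauliWeight M (W.erase j) =
      ∑ S' ∈ stringsOn (W.erase j), ‖pauliCoeff M (Function.update S' j Pauli.I)‖ ^ 2 := by
  rw [pauliWeight_eq]
  refine Finset.sum_congr rfl fun S' hS' => ?_
  have h : S' j = Pauli.I := mem_stringsOn.1 hS' j (Finset.notMem_erase j W)
  rw [← h, Function.update_eq_self]

/-! ### Iterated twirl and the Hilbert–Schmidt expression of the weight -/

/-- The coefficients of the iterated twirl over a list of wires: those with a non-identity
letter on the list are killed, the others kept. [cite: KempeEtAl2010, Observation 4] -/
theorem pauliCoeff_foldr_twirl (L : List ι) (M : Matrix (ι → Bool) (ι → Bool) ℂ) (S : ι → Pauli) :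
    pauliCoeff (L.foldr (fun j N => (1 / 4 : ℂ) • ∑ Q,
      pauliString (Function.update (fun _ : ι => Pauli.I) j Q) * N *
        pauliString (Function.update (fun _ : ι => Pauli.I) j Q)) M) S =
      (if ∀ j ∈ L, S j = Pauli.I then 1 else 0) * pauliCoeff M S := by
  induction L with
  | nil => simp
  | cons j L ih =>
    rw [List.foldr_cons, pauliCoeff_twirl, ih, ← mul_assoc]
    congr 1
    by_cases h : S j = Pauli.I <;> by_cases h' : ∀ k ∈ L, S k = Pauli.I <;> simp [h, h']

/-- The iterated twirl commutes with conjugation by any matrix commuting with the single-site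
Paulis on the list. [folklore] -/
theorem foldr_twirl_conj (L : List ι) (U M : Matrix (ι → Bool) (ι → Bool) ℂ)
    (hU : ∀ j ∈ L, ∀ Q, pauliString (Function.update (fun _ : ι => Pauli.I) j Q) * U =
      U * pauliString (Function.update (fun _ : ι => Pauli.I) j Q)) :
    L.foldr (fun j N => (1 / 4 : ℂ) • ∑ Q,
      pauliString (Function.update (fun _ : ι => Pauli.I) j Q) * N *
        pauliString (Function.update (fun _ : ι => Pauli.I) j Q)) (U * M * Uᴴ) =
    U * L.foldr (fun j N => (1 / 4 : ℂ) • ∑ Q,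
      pauliString (Function.update (fun _ : ι => Pauli.I) j Q) * N *
        pauliString (Function.update (fun _ : ι => Pauli.I) j Q)) M * Uᴴ := by
  induction L with
  | nil => simp
  | cons j L ih =>
    have hL : ∀ k ∈ L, ∀ Q, pauliString (Function.update (fun _ : ι => Pauli.I) k Q) * U =
        U * pauliString (Function.update (fun _ : ι => Pauli.I) k Q) :=
      fun k hk Q => hU k (List.mem_cons_of_mem j hk) Q
    rw [List.foldr_cons, List.foldr_cons, ih hL, Matrix.mul_smul, Matrix.smul_mul, Matrix.mul_sum,
      Matrix.sum_mul]
    congr 1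
    refine Finset.sum_congr rfl fun Q _ => ?_
    have h1 := hU j List.mem_cons_self Q
    have h2 : Uᴴ * pauliString (Function.update (fun _ : ι => Pauli.I) j Q) =
        pauliString (Function.update (fun _ : ι => Pauli.I) j Q) * Uᴴ := by
      have := congrArg Matrix.conjTranspose h1
      simp only [conjTranspose_mul, conjTranspose_pauliString] at this
      exact this
    simp only [Matrix.mul_assoc]
    rw [← Matrix.mul_assoc (pauliString _) U, h1, Matrix.mul_assoc, h2]

/-- **The weight as a Hilbert–Schmidt norm**: if `L` lists the wires outside `W`, then
`pauliWeight M W = 2^{|ι|} Σ_{x,y} |(D_L M) x y|²`, `D_L` the iterated twirl (Parseval applied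
to `D_L M`, whose coefficients are those of `M` on `W` and `0` elsewhere).
[cite: KempeEtAl2010, §2 (Parseval) and Observation 3] -/
theorem pauliWeight_eq_card_pow_mul_norm_twirlList (M : Matrix (ι → Bool) (ι → Bool) ℂ) (W : Finset ι)
    (L : List ι) (hL : ∀ i, i ∈ L ↔ i ∉ W) :
    pauliWeight M W = (2 : ℝ) ^ Fintype.card ι * ∑ x, ∑ y,
      ‖(L.foldr (fun j N => (1 / 4 : ℂ) • ∑ Q,
        pauliString (Function.update (fun _ : ι => Pauli.I) j Q) * N *
          pauliString (Function.update (fun _ : ι => Pauli.I) j Q)) M) x y‖ ^ 2 := by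
  rw [← sum_norm_pauliCoeff_sq, pauliWeight_eq]
  simp only [pauliCoeff_foldr_twirl]
  rw [← Finset.sum_subset (Finset.subset_univ (stringsOn W))]
  · refine Finset.sum_congr rfl fun S hS => ?_
    rw [if_pos fun j hj => mem_stringsOn.1 hS j ((hL j).1 hj), one_mul]
  · intro S _ hS
    rw [if_neg, zero_mul, norm_zero]
    · ring
    · intro h
      exact hS (mem_stringsOn.2 fun i hi => h i ((hL i).2 hi))

/-- The Hilbert–Schmidt norm is invariant under unitary conjugation. [folklore] -/
theorem sum_norm_sq_unitary_conj {m : Type*} [Fintype m] [DecidableEq m] (U M : Matrix m m ℂ)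
    (hU : Uᴴ * U = 1) : ∑ x, ∑ y, ‖(U * M * Uᴴ) x y‖ ^ 2 = ∑ x, ∑ y, ‖M x y‖ ^ 2 := by
  have key : ∀ N : Matrix m m ℂ, ((∑ x, ∑ y, ‖N x y‖ ^ 2 : ℝ) : ℂ) = (N * Nᴴ).trace := by
    intro N
    simp [Matrix.trace, Matrix.mul_apply, Complex.mul_conj']
  apply Complex.ofReal_injective
  rw [key, key, conjTranspose_mul, conjTranspose_mul, conjTranspose_conjTranspose]
  calc (U * M * Uᴴ * (U * (Mᴴ * Uᴴ))).trace = (U * (M * Mᴴ) * Uᴴ).trace := by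
        congr 1
        simp only [Matrix.mul_assoc]
        rw [← Matrix.mul_assoc Uᴴ U, hU, Matrix.one_mul]
    _ = (M * Mᴴ).trace := by
        rw [trace_mul_cycle, hU, Matrix.one_mul]

/-- **Unitary invariance of the Pauli weight** (Observation 2, localised): if `U` is unitary
and commutes with every single-site Pauli outside `W` (it "acts inside `W`"), then
`pauliWeight (U M Uᴴ) W = pauliWeight M W`. [cite: KempeEtAl2010, Observation 2 and §3.1.2 Case 1] -/
theorem pauliWeight_unitary_conj (M U : Matrix (ι → Bool) (ι → Bool) ℂ) (W : Finset ι)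
    (hU : Uᴴ * U = 1)
    (hcomm : ∀ j, j ∉ W → ∀ Q, pauliString (Function.update (fun _ : ι => Pauli.I) j Q) * U =
      U * pauliString (Function.update (fun _ : ι => Pauli.I) j Q)) :
    pauliWeight (U * M * Uᴴ) W = pauliWeight M W := by
  classical
  set L := (Finset.univ \ W).toList with hL
  have hL' : ∀ i, i ∈ L ↔ i ∉ W := fun i => by simp [hL]
  rw [pauliWeight_eq_card_pow_mul_norm_twirlList _ W L hL',
    pauliWeight_eq_card_pow_mul_norm_twirlList M W L hL',
    foldr_twirl_conj L U M fun j hj Q => hcomm j ((hL' j).1 hj) Q, sum_norm_sq_unitary_conj _ _ hU]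

end Literature.Computability.QuantumComplexity
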